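import Mathlib.RepresentationTheory.Invariants
import Mathlib.LinearAlgebra.Eigenspace.Basic
import Mathlib.LinearAlgebra.Projection
import Mathlib.RingTheory.IntegralDomain
import HarnessLib

/-!
# Route `PrintCFram`, crux C2 `BottomClassIndexLawFiveLe` (stmt-BirchSwinnertonDyer-20372), line
# `eisenstein-resource-bdp-line` v10, Stub H `stub_bottomResidualSelmer_trivial_of_bernoulliPair`, typing item T3 of
# `Lines/herbrand-regular-locus-M1-anatomy.md` §8: EIGENSPACE PROJECTORS `e_χ` FOR A FINITE GROUP OF INVERTIBLE ORDER
# (cell `bsd-print-cfram`, seat `bsd-line-cfram-p1-w4` g4; helper `--supports` 20372; 0 facts, 0 defs)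

HONEST FRAMING. Nothing about BSD is proved here. Pure algebra (the `ℤ_p[G]`-module bookkeeping behind the
class-field-theory bound (M1) of the herbrand line, anatomy §§3–5: "taking `θ`-parts is exact (`p ∤ |Δ|`)", the
idempotents `e_χ = |G|⁻¹ Σ_g χ⁻¹(g) g ∈ ℤ_p[G]`). For a commutative ring `k`, a group `G`, a `k`-linear representation
`ρ : Representation k G V` and a character `χ : G →* kˣ`, the **`χ`-eigenspace** (the `χ`-part `V^{(χ)}`) is written
definition-free as the joint eigenspace `⨅ g, Module.End.eigenspace (ρ g) (χ g)` (`mem_iInf_eigenspace_iff`: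
`v ∈ V^{(χ)} ↔ ∀ g, ρ g v = χ g • v`; for `χ = 1` it is Mathlib's `ρ.invariants`, `iInf_eigenspace_one_eq_invariants`).
For `G` finite of order invertible in `k`, the **projector** `e_χ = ⅟|G| • Σ_g χ(g⁻¹) • ρ g ∈ End_k V` (again written
out, no definition) satisfies `ρ h ∘ e_χ = χ h • e_χ` (`apply_sum_apply`), lands in `V^{(χ)}` (`proj_mem`) and fixes it
(`proj_eq_self`): `isProj_iInf_eigenspace` (Mathlib `LinearMap.IsProj`), whence `range e_χ = V^{(χ)}`,
`V = V^{(χ)} ⊕ ker e_χ` (`isCompl_iInf_eigenspace_ker`). **Exactness of `V ↦ V^{(χ)}`**: a `G`-equivariant linear map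
commutes with the projectors (`comp_proj_eq_proj_comp`), maps `χ`-parts to `χ`-parts (`map_iInf_eigenspace_le`), ONTO
if it is onto (`map_iInf_eigenspace_eq_of_surjective`), and an exact pair `range f = ker f'` stays exact on `χ`-parts
(`map_iInf_eigenspace_eq_inf_ker`); injective maps reflect `χ`-parts (`mem_iInf_eigenspace_iff_of_injective`).
**Orthogonality** over a DOMAIN `k` (no unit hypothesis, `V` may be torsion — e.g. `Cl_L ⊗ ℤ_p` over `ℤ_p`):
`Σ_g φ(g) = 0` for a character `φ ≠ 1` (`sum_units_val_eq_zero_of_ne_one`, Mathlib `sum_hom_units_eq_zero`), so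
`e_χ` kills `V^{(ψ)}` for `ψ ≠ χ` (`proj_apply_eq_zero_of_mem_of_ne`) and `V^{(χ)} ⊓ V^{(ψ)} = ⊥`
(`disjoint_iInf_eigenspace`). Sequel files: the decomposition `V = ⊕_χ V^{(χ)}` for abelian `G`
(`…HerbrandEigenspaceDecomposition`) and the `χ`-parts of induced / permutation modules (`…HerbrandEigenspaceInduced`).

THEOREMS ONLY; no definition, no named fact, no `sorry`; imports no `Theses` module. BSD is not proved by any of
this; no summit statement is proved by this seat.
References: [Washington1997] §6.3 (the idempotents `ε_χ` of `ℤ_p[Δ]`, `p ∤ |Δ|`, and `χ`-components);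
[Lang1990] Ch. 1 §3; [SerreLinearRepresentations1977] §2.6 Thm. 8 (canonical decomposition and its projectors).
-/

set_option autoImplicit false
-- `…BirchSwinnertonDyer.BirchSwinnertonDyer.Theorems…` is the problem's mandated namespace (D-0017).
set_option linter.dupNamespace false

namespace Summit.BirchSwinnertonDyer.BirchSwinnertonDyer.Theorems.PrintCFram.HerbrandEigenspace

open Module Module.End

/-! ## The joint eigenspace `V^{(χ)} = ⨅_g eigenspace (ρ g) (χ g)` -/

section JointEigenspace

variable {k G V : Type*} [CommRing k] [Group G] [AddCommGroup V] [Module k V]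
  (ρ : Representation k G V) (χ : G →* kˣ)

/-- Membership in the `χ`-part: `v ∈ V^{(χ)} ↔ ρ(g) v = χ(g) v` for all `g`.
[cite: Washington1997, §6.3] [folklore] -/
theorem mem_iInf_eigenspace_iff (v : V) :
    v ∈ ⨅ g : G, eigenspace (ρ g) (χ g : k) ↔ ∀ g : G, ρ g v = (χ g : k) • v := by
  simp only [Submodule.mem_iInf, mem_eigenspace_iff]

/-- The `χ`-part is `G`-stable. [folklore] -/
theorem apply_mem_iInf_eigenspace (h : G) {v : V} (hv : v ∈ ⨅ g : G, eigenspace (ρ g) (χ g : k)) :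
    ρ h v ∈ ⨅ g : G, eigenspace (ρ g) (χ g : k) := by
  rw [mem_iInf_eigenspace_iff] at hv ⊢
  intro g
  rw [hv h, map_smul, hv g]
  exact smul_comm _ _ _

/-- For the trivial character the `χ`-part is the module of invariants `V^G` (Mathlib
`Representation.invariants`). [folklore] -/
theorem iInf_eigenspace_one_eq_invariants :
    (⨅ g : G, eigenspace (ρ g) ((1 : G →* kˣ) g : k)) = ρ.invariants := by
  ext v
  rw [mem_iInf_eigenspace_iff, Representation.mem_invariants]
  simp only [MonoidHom.one_apply, Units.val_one, one_smul]

/-- A character sum over a finite group vanishes for a non-trivial `kˣ`-valued character, `k` a domain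
(Mathlib `sum_hom_units_eq_zero` for the composite `G →* kˣ →* k`). [folklore] -/
theorem sum_units_val_eq_zero_of_ne_one [Fintype G] [IsDomain k] (φ : G →* kˣ) (hφ : φ ≠ 1) :
    ∑ g : G, (φ g : k) = 0 := by
  have h : (Units.coeHom k).comp φ ≠ 1 := by
    intro h
    apply hφ
    refine MonoidHom.ext fun g => ?_
    have hg : ((φ g : kˣ) : k) = 1 := by
      simpa only [MonoidHom.comp_apply, Units.coeHom_apply, MonoidHom.one_apply] using
        DFunLike.congr_fun h g
    rw [MonoidHom.one_apply]
    exact Units.val_eq_one.mp hg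
  simpa only [MonoidHom.comp_apply, Units.coeHom_apply] using sum_hom_units_eq_zero _ h

/-! ## The twisted trace `S_χ = Σ_g χ(g⁻¹) • ρ g` and the projector `e_χ = ⅟|G| • S_χ` -/

variable [Fintype G]

/-- `S_χ v = Σ_g χ(g⁻¹) • ρ(g) v`. [folklore] -/
theorem sum_apply (v : V) :
    (∑ g : G, ((χ g⁻¹ : kˣ) : k) • ρ g) v = ∑ g : G, ((χ g⁻¹ : kˣ) : k) • ρ g v := by
  simp only [LinearMap.sum_apply, LinearMap.smul_apply]

/-- **`ρ(h) ∘ S_χ = χ(h) • S_χ`**: reindex `g ↦ h g` in `Σ_g χ(g⁻¹) ρ(hg)`.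
[cite: Washington1997, §6.3] [folklore] -/
theorem apply_sum_apply (h : G) (v : V) :
    ρ h ((∑ g : G, ((χ g⁻¹ : kˣ) : k) • ρ g) v) =
      (χ h : k) • (∑ g : G, ((χ g⁻¹ : kˣ) : k) • ρ g) v := by
  simp only [LinearMap.sum_apply, LinearMap.smul_apply, map_sum, map_smul]
  calc ∑ g : G, ((χ g⁻¹ : kˣ) : k) • ρ h (ρ g v)
      = ∑ g : G, ((χ ((h * g)⁻¹ * h) : kˣ) : k) • ρ (h * g) v := by
        refine Finset.sum_congr rfl fun g _ => ?_
        rw [map_mul ρ, Module.End.mul_apply, mul_inv_rev, inv_mul_cancel_right]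
    _ = ∑ g : G, ((χ (g⁻¹ * h) : kˣ) : k) • ρ g v :=
        Fintype.sum_bijective (fun g => h * g) (Group.mulLeft_bijective h) _
          (fun g => ((χ (g⁻¹ * h) : kˣ) : k) • ρ g v) fun _ => rfl
    _ = (χ h : k) • ∑ g : G, ((χ g⁻¹ : kˣ) : k) • ρ g v := by
        rw [Finset.smul_sum]
        refine Finset.sum_congr rfl fun g _ => ?_
        rw [map_mul, Units.val_mul, mul_smul]
        exact smul_comm _ _ _

/-- `S_χ` maps into the `χ`-part. [folklore] -/
theorem sum_apply_mem (v : V) :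
    (∑ g : G, ((χ g⁻¹ : kˣ) : k) • ρ g) v ∈ ⨅ g : G, eigenspace (ρ g) (χ g : k) := by
  rw [mem_iInf_eigenspace_iff]
  exact fun h => apply_sum_apply ρ χ h v

/-- On the `χ`-part, `S_χ` is multiplication by `|G|`. [folklore] -/
theorem sum_apply_eq_card_smul {v : V} (hv : v ∈ ⨅ g : G, eigenspace (ρ g) (χ g : k)) :
    (∑ g : G, ((χ g⁻¹ : kˣ) : k) • ρ g) v = (Fintype.card G : k) • v := by
  rw [mem_iInf_eigenspace_iff] at hv
  have h1 : ∀ g : G, ((χ g⁻¹ : kˣ) : k) • ρ g v = v := fun g => by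
    rw [hv g, smul_smul, ← Units.val_mul, ← map_mul, inv_mul_cancel, map_one, Units.val_one, one_smul]
  simp only [sum_apply, h1, Finset.sum_const, Finset.card_univ, Nat.cast_smul_eq_nsmul]

/-- An equivariant linear map commutes with the twisted traces: `f ∘ S_χ^ρ = S_χ^σ ∘ f`. [folklore] -/
theorem comp_sum_eq_sum_comp {W : Type*} [AddCommGroup W] [Module k W] (σ : Representation k G W)
    (f : V →ₗ[k] W) (hf : ∀ g : G, f ∘ₗ ρ g = σ g ∘ₗ f) :
    f ∘ₗ (∑ g : G, ((χ g⁻¹ : kˣ) : k) • ρ g) = (∑ g : G, ((χ g⁻¹ : kˣ) : k) • σ g) ∘ₗ f := by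
  refine LinearMap.ext fun v => ?_
  simp only [LinearMap.comp_apply, sum_apply, map_sum, map_smul]
  refine Finset.sum_congr rfl fun g _ => ?_
  have e := LinearMap.congr_fun (hf g) v
  simp only [LinearMap.comp_apply] at e
  rw [e]

variable [Invertible (Fintype.card G : k)]

/-- `e_χ v = ⅟|G| • S_χ v`. [folklore] -/
theorem proj_apply (v : V) :
    (⅟(Fintype.card G : k) • ∑ g : G, ((χ g⁻¹ : kˣ) : k) • ρ g) v =
      ⅟(Fintype.card G : k) • ∑ g : G, ((χ g⁻¹ : kˣ) : k) • ρ g v := by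
  rw [LinearMap.smul_apply, sum_apply]

/-- **The projector lands in the `χ`-part**: `e_χ v ∈ V^{(χ)}`. [cite: Washington1997, §6.3] [folklore] -/
theorem proj_mem (v : V) :
    (⅟(Fintype.card G : k) • ∑ g : G, ((χ g⁻¹ : kˣ) : k) • ρ g) v ∈
      ⨅ g : G, eigenspace (ρ g) (χ g : k) := by
  rw [LinearMap.smul_apply]
  exact Submodule.smul_mem _ _ (sum_apply_mem ρ χ v)

/-- **The projector fixes the `χ`-part**: `e_χ v = v` for `v ∈ V^{(χ)}` (uses `|G| ∈ kˣ`).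
[cite: Washington1997, §6.3] [folklore] -/
theorem proj_eq_self {v : V} (hv : v ∈ ⨅ g : G, eigenspace (ρ g) (χ g : k)) :
    (⅟(Fintype.card G : k) • ∑ g : G, ((χ g⁻¹ : kˣ) : k) • ρ g) v = v := by
  rw [LinearMap.smul_apply, sum_apply_eq_card_smul ρ χ hv, smul_smul, invOf_mul_self, one_smul]

/-- **`e_χ` is a projection onto `V^{(χ)}`** (Mathlib `LinearMap.IsProj`). [cite: Washington1997, §6.3] [folklore] -/
theorem isProj_iInf_eigenspace :
    LinearMap.IsProj (⨅ g : G, eigenspace (ρ g) (χ g : k))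
      (⅟(Fintype.card G : k) • ∑ g : G, ((χ g⁻¹ : kˣ) : k) • ρ g) :=
  ⟨proj_mem ρ χ, fun _ hv => proj_eq_self ρ χ hv⟩

/-- `range e_χ = V^{(χ)}`. [folklore] -/
theorem range_proj :
    LinearMap.range (⅟(Fintype.card G : k) • ∑ g : G, ((χ g⁻¹ : kˣ) : k) • ρ g) =
      ⨅ g : G, eigenspace (ρ g) (χ g : k) :=
  (isProj_iInf_eigenspace ρ χ).range

/-- `e_χ ∘ e_χ = e_χ`. [folklore] -/
theorem isIdempotentElem_proj :
    IsIdempotentElem (⅟(Fintype.card G : k) • ∑ g : G, ((χ g⁻¹ : kˣ) : k) • ρ g) :=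
  (isProj_iInf_eigenspace ρ χ).isIdempotentElem

/-- `V = V^{(χ)} ⊕ ker e_χ`: the `χ`-part is a direct summand. [folklore] -/
theorem isCompl_iInf_eigenspace_ker :
    IsCompl (⨅ g : G, eigenspace (ρ g) (χ g : k))
      (LinearMap.ker (⅟(Fintype.card G : k) • ∑ g : G, ((χ g⁻¹ : kˣ) : k) • ρ g)) :=
  (isProj_iInf_eigenspace ρ χ).isCompl

/-- `v ∈ V^{(χ)} ↔ e_χ v = v`. [folklore] -/
theorem mem_iInf_eigenspace_iff_proj_eq (v : V) :
    v ∈ ⨅ g : G, eigenspace (ρ g) (χ g : k) ↔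
      (⅟(Fintype.card G : k) • ∑ g : G, ((χ g⁻¹ : kˣ) : k) • ρ g) v = v :=
  (isProj_iInf_eigenspace ρ χ).mem_iff_map_id

/-- `V^{(χ)} = 0 ↔ e_χ = 0`. [folklore] -/
theorem iInf_eigenspace_eq_bot_iff :
    (⨅ g : G, eigenspace (ρ g) (χ g : k)) = ⊥ ↔
      (⅟(Fintype.card G : k) • ∑ g : G, ((χ g⁻¹ : kˣ) : k) • ρ g) = 0 :=
  (isProj_iInf_eigenspace ρ χ).submodule_eq_bot_iff

end JointEigenspace

/-! ## Exactness of `V ↦ V^{(χ)}` -/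

section Exactness

variable {k G U V W : Type*} [CommRing k] [Group G] [AddCommGroup U] [Module k U] [AddCommGroup V] [Module k V]
  [AddCommGroup W] [Module k W] (τ : Representation k G U) (ρ : Representation k G V) (σ : Representation k G W)
  (χ : G →* kˣ)

/-- An equivariant linear map carries `χ`-parts into `χ`-parts (no finiteness needed). [folklore] -/
theorem map_iInf_eigenspace_le (f : V →ₗ[k] W) (hf : ∀ g : G, f ∘ₗ ρ g = σ g ∘ₗ f) :
    (⨅ g : G, eigenspace (ρ g) (χ g : k)).map f ≤ ⨅ g : G, eigenspace (σ g) (χ g : k) := by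
  intro w hw
  obtain ⟨v, hv, rfl⟩ := Submodule.mem_map.mp hw
  rw [mem_iInf_eigenspace_iff] at hv ⊢
  intro g
  have e := LinearMap.congr_fun (hf g) v
  simp only [LinearMap.comp_apply] at e
  rw [← e, hv g, map_smul]

/-- An INJECTIVE equivariant linear map reflects `χ`-parts: `u ∈ U^{(χ)} ↔ f u ∈ V^{(χ)}` (left exactness).
[folklore] -/
theorem mem_iInf_eigenspace_iff_of_injective (f : U →ₗ[k] V) (hf : ∀ g : G, f ∘ₗ τ g = ρ g ∘ₗ f)
    (hinj : Function.Injective f) (u : U) :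
    u ∈ ⨅ g : G, eigenspace (τ g) (χ g : k) ↔ f u ∈ ⨅ g : G, eigenspace (ρ g) (χ g : k) := by
  refine ⟨fun hu => map_iInf_eigenspace_le τ ρ χ f hf (Submodule.mem_map_of_mem hu), fun hfu => ?_⟩
  rw [mem_iInf_eigenspace_iff] at hfu ⊢
  intro g
  apply hinj
  have e := LinearMap.congr_fun (hf g) u
  simp only [LinearMap.comp_apply] at e
  rw [e, hfu g, map_smul]

variable [Fintype G] [Invertible (Fintype.card G : k)]

/-- An equivariant linear map commutes with the projectors: `f ∘ e_χ^ρ = e_χ^σ ∘ f`. [folklore] -/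
theorem comp_proj_eq_proj_comp (f : V →ₗ[k] W) (hf : ∀ g : G, f ∘ₗ ρ g = σ g ∘ₗ f) :
    f ∘ₗ (⅟(Fintype.card G : k) • ∑ g : G, ((χ g⁻¹ : kˣ) : k) • ρ g) =
      (⅟(Fintype.card G : k) • ∑ g : G, ((χ g⁻¹ : kˣ) : k) • σ g) ∘ₗ f := by
  rw [LinearMap.comp_smul, LinearMap.smul_comp, comp_sum_eq_sum_comp ρ χ σ f hf]

/-- **Right exactness**: an equivariant SURJECTION maps `V^{(χ)}` ONTO `W^{(χ)}` (`w = e_χ w = e_χ (f v) = f (e_χ v)`).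
[cite: Washington1997, §6.3] [folklore] -/
theorem map_iInf_eigenspace_eq_of_surjective (f : V →ₗ[k] W) (hf : ∀ g : G, f ∘ₗ ρ g = σ g ∘ₗ f)
    (hsurj : Function.Surjective f) :
    (⨅ g : G, eigenspace (ρ g) (χ g : k)).map f = ⨅ g : G, eigenspace (σ g) (χ g : k) := by
  refine le_antisymm (map_iInf_eigenspace_le ρ σ χ f hf) fun w hw => ?_
  obtain ⟨v, rfl⟩ := hsurj w
  refine Submodule.mem_map.mpr ⟨_, proj_mem ρ χ v, ?_⟩
  rw [← LinearMap.comp_apply, comp_proj_eq_proj_comp ρ σ χ f hf, LinearMap.comp_apply, proj_eq_self σ χ hw]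

/-- **Exactness in the middle**: if `U → V → W` is an exact pair of equivariant maps (`range f = ker f'`), then
`f(U^{(χ)}) = V^{(χ)} ∩ ker f'`, i.e. `U^{(χ)} → V^{(χ)} → W^{(χ)}` is exact. [cite: Washington1997, §6.3] [folklore] -/
theorem map_iInf_eigenspace_eq_inf_ker (f : U →ₗ[k] V) (f' : V →ₗ[k] W)
    (hf : ∀ g : G, f ∘ₗ τ g = ρ g ∘ₗ f) (hex : LinearMap.range f = LinearMap.ker f') :
    (⨅ g : G, eigenspace (τ g) (χ g : k)).map f =
      (⨅ g : G, eigenspace (ρ g) (χ g : k)) ⊓ LinearMap.ker f' := by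
  refine le_antisymm (le_inf (map_iInf_eigenspace_le τ ρ χ f hf) ?_) fun v hv => ?_
  · rw [← hex]
    exact LinearMap.map_le_range
  · obtain ⟨hv, hv'⟩ := Submodule.mem_inf.mp hv
    have hvr : v ∈ LinearMap.range f := hex ▸ hv'
    obtain ⟨u, rfl⟩ := LinearMap.mem_range.mp hvr
    refine Submodule.mem_map.mpr ⟨_, proj_mem τ χ u, ?_⟩
    rw [← LinearMap.comp_apply, comp_proj_eq_proj_comp τ ρ χ f hf, LinearMap.comp_apply, proj_eq_self ρ χ hv]

/-- The `χ`-part of a quotient-like surjection is zero as soon as the `χ`-part of the source is: `V^{(χ)} = 0 ⟹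
W^{(χ)} = 0` for an equivariant surjection `V ↠ W`. [folklore] -/
theorem iInf_eigenspace_eq_bot_of_surjective (f : V →ₗ[k] W) (hf : ∀ g : G, f ∘ₗ ρ g = σ g ∘ₗ f)
    (hsurj : Function.Surjective f) (hV : (⨅ g : G, eigenspace (ρ g) (χ g : k)) = ⊥) :
    (⨅ g : G, eigenspace (σ g) (χ g : k)) = ⊥ := by
  rw [← map_iInf_eigenspace_eq_of_surjective ρ σ χ f hf hsurj, hV, Submodule.map_bot]

end Exactness

/-! ## Orthogonality of distinct characters over a domain -/

section Orthogonality

variable {k G V : Type*} [CommRing k] [IsDomain k] [Group G] [Fintype G] [AddCommGroup V] [Module k V]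
  (ρ : Representation k G V) {χ ψ : G →* kˣ}

/-- Over a domain, the twisted trace `S_χ` KILLS the `ψ`-part for `ψ ≠ χ`:
`S_χ v = (Σ_g χ(g⁻¹)ψ(g)) v = 0` by `sum_units_val_eq_zero_of_ne_one` for `χ⁻¹ψ ≠ 1` — no unit or torsion-freeness
hypothesis on `V`. [cite: Washington1997, §6.3] [folklore] -/
theorem sum_apply_eq_zero_of_mem_of_ne (hne : χ ≠ ψ) {v : V} (hv : v ∈ ⨅ g : G, eigenspace (ρ g) (ψ g : k)) :
    (∑ g : G, ((χ g⁻¹ : kˣ) : k) • ρ g) v = 0 := by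
  rw [mem_iInf_eigenspace_iff] at hv
  have h1 : ∀ g : G, ((χ g⁻¹ : kˣ) : k) • ρ g v = (((χ⁻¹ * ψ) g : kˣ) : k) • v := fun g => by
    rw [hv g, smul_smul, ← Units.val_mul, MonoidHom.mul_apply, MonoidHom.inv_apply, map_inv]
  have hne' : χ⁻¹ * ψ ≠ 1 := fun h => hne (inv_mul_eq_one.mp h)
  rw [sum_apply]
  simp only [h1, ← Finset.sum_smul, sum_units_val_eq_zero_of_ne_one _ hne', zero_smul]

variable [Invertible (Fintype.card G : k)]

/-- Over a domain, `e_χ` kills `V^{(ψ)}` for `ψ ≠ χ`. [cite: Washington1997, §6.3] [folklore] -/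
theorem proj_apply_eq_zero_of_mem_of_ne (hne : χ ≠ ψ) {v : V} (hv : v ∈ ⨅ g : G, eigenspace (ρ g) (ψ g : k)) :
    (⅟(Fintype.card G : k) • ∑ g : G, ((χ g⁻¹ : kˣ) : k) • ρ g) v = 0 := by
  rw [LinearMap.smul_apply, sum_apply_eq_zero_of_mem_of_ne ρ hne hv, smul_zero]

/-- Over a domain, distinct `χ`-parts are DISJOINT: `V^{(χ)} ⊓ V^{(ψ)} = ⊥` for `χ ≠ ψ` (`v = e_χ v = 0`).
[cite: Washington1997, §6.3] [folklore] -/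
theorem disjoint_iInf_eigenspace (hne : χ ≠ ψ) :
    Disjoint (⨅ g : G, eigenspace (ρ g) (χ g : k)) (⨅ g : G, eigenspace (ρ g) (ψ g : k)) := by
  rw [Submodule.disjoint_def]
  intro v hvχ hvψ
  rw [← proj_eq_self ρ χ hvχ]
  exact proj_apply_eq_zero_of_mem_of_ne ρ hne hvψ

/-- The composite of the projectors of two distinct characters vanishes: `e_χ ∘ e_ψ = 0` (domain).
[cite: Washington1997, §6.3] [folklore] -/
theorem proj_comp_proj_eq_zero_of_ne (hne : χ ≠ ψ) :
    (⅟(Fintype.card G : k) • ∑ g : G, ((χ g⁻¹ : kˣ) : k) • ρ g) ∘ₗ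
      (⅟(Fintype.card G : k) • ∑ g : G, ((ψ g⁻¹ : kˣ) : k) • ρ g) = 0 := by
  refine LinearMap.ext fun v => ?_
  rw [LinearMap.comp_apply, LinearMap.zero_apply]
  exact proj_apply_eq_zero_of_mem_of_ne ρ hne (proj_mem ρ ψ v)

end Orthogonality

end Summit.BirchSwinnertonDyer.BirchSwinnertonDyer.Theorems.PrintCFram.HerbrandEigenspace
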